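import Literature.Geometry.Kaehler.ChernCharacter
import Literature.Geometry.Kaehler.AtlasCocycle
import Literature.Geometry.Kaehler.ConnectionExists
import Literature.Geometry.Kaehler.UnitaryConnectionCocycle
import Literature.Geometry.Kaehler.ApproxHermitianYangMills
import HarnessLib

/-!
# The Chern character `ch_k(F) ∈ H^{2k}(M; ℂ)` of a `C^∞` Hermitian vector bundle

Layer `Literature/Geometry/Kaehler`. The definition requested by route
`HodgeConjecture/HolomorphicDefect` (items `stmt-HodgeConjecture-3028/3029/3030`):

  `SmoothHermitianBundle.chernCharacter (F : SmoothHermitianBundle E M)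
    (ι : ComplexDeRhamIsoFamily E) (k : ℕ) : singularCohomology ℂ ℂ M (2 * k)`,

the `k`-th component of the Chern character of the `C^∞` complex vector bundle underlying the
`C^∞` Hermitian bundle `F` (`ApproxHermitianYangMills.lean`: Mathlib `FiberBundle`/`VectorBundle ℂ`
data with real-`C^∞` transition operators and a smooth Hermitian structure), by Chern–Weil theory
(Kobayashi (1987), Ch. II §2, (2.20)–(2.21), Thm. 2.16: `ch_k(E)` is represented by the closed form
`(1/k!) tr((−Ω/2πi)ᵏ)` for any connection, (2.4), (2.10)) transported to singular cohomology with
complex coefficients through the given complex de Rham comparison family `ι`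
(`Transcendental/DeRhamTheorem`; a Hodge model `A` supplies `A.deRham`).

Assembly of three tree files:
* `AtlasCocycle`: the transition cocycle `F.toCocycle : SmoothComplexVectorBundle M E M F.rank` of
  the Mathlib bundle `F.V` in the reference orthonormal basis of the model fibre (Kobayashi I (1.15)),
  smooth by the carrier's field `contMDiffOn_coordChangeL` (`isSmoothCocycle`);
* `ChernCharacter`: `SmoothComplexVectorBundle.chernCharacter` (Chern–Weil classes of cocycle
  bundles, the two named facts `exists_isChernCharacterForm` / `mk_eq_mk_of_isChernCharacterForm` of
  Kobayashi II §2, Whitney sums);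
* `UnitaryConnectionCocycle`: the carrier's smooth unitary connections (atlas frames, `End`-valued
  forms) are connections on `F.toCocycle` (`UnitaryConnection.toConnection`), so they compute
  `ch_k(F)` (`chernCharacter_eq_of_unitaryConnection`);
* `ConnectionExists`: every such cocycle carries a connection (partition of unity), so the
  Chern–Weil class is never the junk value (`chernCharacterDeRham_mem`) and additivity holds without
  extra hypotheses.

API (the route's requirements): `chernCharacter_eq` (INDEPENDENCE OF THE CONNECTION: granted
Chern–Weil II, `ch_k(F) = ι[θ]` for the global Chern character form `θ` of ANY connection on the
cocycle of `F`), `chernCharacter_zero` (`ch₀ = rank`, unconditional), `chernCharacter_directSum`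
(ADDITIVITY under the Whitney sum of the underlying cocycles, granted the two facts; the Hermitian
carrier has no Whitney sum of its own — the reference inner product of a product fibre is not
Mathlib's product norm — so additivity is stated for `F.toCocycle.directSum G.toCocycle`, which is the
`C^∞` bundle `F ⊕ G` presented on the common refinement of the two atlases, Kobayashi I (5.14)),
and the values on the trivial bundle (`ch₀ = dim F`, `ch_{k+1} = 0` granted Chern–Weil II).
Hermitian metrics play no role (any connection computes `ch_k`, (2.10)); that `ch_k` of an
(approximately) Hermitian–Yang–Mills bundle on a compact Kähler manifold is of type `(k,k)` is a
separate statement, not made here.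

## References

* [Kobayashi1987] S. Kobayashi, Differential Geometry of Complex Vector Bundles (1987), Ch. I §1
  (1.15)–(1.16), §5 (5.14); Ch. II §1 (1.9)–(1.10), §2 (2.4), (2.10), (2.20)–(2.21), Thm. 2.16.
* R. O. Wells, Differential Analysis on Complex Manifolds (1980), Ch. III §3.
* R. Bott, L. W. Tu, Differential Forms in Algebraic Topology (1982), §23.
-/

noncomputable section

open scoped Manifold ContDiff Topology Matrix
open Set Bundle Module

namespace Literature.Geometry.Kaehler

universe u

namespace SmoothHermitianBundle

open Literature.NumberTheory.Transcendental (ComplexDeRhamIsoFamily complexDeRhamCohomology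
  mem_cclosedSmoothForms cclosedSmoothForms)
open Literature.AlgebraicTopology.SingularHomology (singularCohomology)

variable {E : Type u} [NormedAddCommGroup E] [NormedSpace ℂ E]
  {M : Type u} [TopologicalSpace M] [ChartedSpace E M]

/-! ### The transition cocycle of a `C^∞` Hermitian bundle -/

/-- The transition operators of the atlas of `F` (`atlasCoordChange`, from the frame at `x₁` to the
frame at `x₀`) are the carrier's `atlasTransition` with the indices exchanged (definitional).
[cite: Kobayashi1987, Ch. I §1 (1.15)] -/
theorem atlasCoordChange_eq_atlasTransition (F : SmoothHermitianBundle E M) (x₀ x₁ x : M) :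
    atlasCoordChange F.Fiber F.V x₀ x₁ x = atlasTransition F.V x₁ x₀ x :=
  rfl

/-- The cocycle of a `C^∞` Hermitian bundle is smooth: its field `contMDiffOn_coordChangeL` applied to
the trivializations of the atlas. [cite: Kobayashi1987, Ch. I §1 (1.15)] -/
theorem isSmoothCocycle (F : SmoothHermitianBundle E M) : IsSmoothCocycle E F.Fiber F.V := fun x₀ x₁ ↦ by
  rw [inter_comm]
  exact F.contMDiffOn_coordChangeL (trivializationAt F.Fiber F.V x₁) (trivializationAt F.Fiber F.V x₀)

/-- The reference basis of the model fibre: the standard orthonormal basis of `F.Fiber`, indexed by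
`Fin F.rank` (Kobayashi's unitary reference frame, I.(4.3)). [cite: Kobayashi1987, I.(4.3)] -/
def frameBasis (F : SmoothHermitianBundle E M) : Module.Basis (Fin F.rank) ℂ F.Fiber :=
  (stdOrthonormalBasis ℂ F.Fiber).toBasis

/-- **The transition cocycle of `F`**: the `C^∞` complex vector bundle of rank `r = F.rank` presented
by the cocycle of the atlas of `F.V` read in the reference basis (`AtlasCocycle.ofVectorBundle`:
index type `M`, cover `U_{x₀} = (trivializationAt F.Fiber F.V x₀).baseSet`, matrices
`g_{x₀x₁} = [coordChangeL]_b`) — the `C^∞` complex vector bundle underlying `F`, in the format of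
`ComplexVectorBundle.lean` on which connections, curvature and Chern character forms live.
[cite: Kobayashi1987, Ch. I §1 (1.15)] -/
def toCocycle (F : SmoothHermitianBundle E M) : SmoothComplexVectorBundle M E M F.rank :=
  SmoothComplexVectorBundle.ofVectorBundle F.Fiber F.V F.frameBasis F.isSmoothCocycle

/-- The trivialising sets of the cocycle of `F` are the base sets of its atlas (definitional).
[folklore] -/
@[simp]
theorem toCocycle_baseSet (F : SmoothHermitianBundle E M) (x₀ : M) :
    F.toCocycle.baseSet x₀ = (trivializationAt F.Fiber F.V x₀).baseSet :=
  rfl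

/-- The transition matrices of the cocycle of `F` (definitional). [cite: Kobayashi1987, Ch. I §1 (1.15)] -/
theorem toCocycle_coordChange (F : SmoothHermitianBundle E M) (x₀ x₁ x : M) :
    F.toCocycle.coordChange x₀ x₁ x =
      LinearMap.toMatrix F.frameBasis F.frameBasis (atlasCoordChange F.Fiber F.V x₀ x₁ x : F.Fiber →ₗ[ℂ] F.Fiber) :=
  rfl

/-- The class of the zero form is zero (any universe; cf. `SmoothComplexVectorBundle.mk_zero_eq_zero`).
[folklore] -/
theorem complexDeRhamCohomology_mk_zero (k : ℕ) :
    complexDeRhamCohomology.mk E M k ⟨0, mem_cclosedSmoothForms isSmoothForm_zero mextDeriv_zero⟩ = 0 := by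
  have h0 : (⟨0, mem_cclosedSmoothForms isSmoothForm_zero mextDeriv_zero⟩ : cclosedSmoothForms E M k) = 0 :=
    rfl
  rw [h0, map_zero]

/-! ### The Chern character -/

variable [IsManifold 𝓘(ℝ, E) ∞ M] [T2Space M] [SigmaCompactSpace M]

/-- **The `k`-th Chern character `ch_k(F) ∈ H^{2k}(M; ℂ)` of the `C^∞` Hermitian vector bundle `F`**
on the real-`C^∞`, Hausdorff, σ-compact manifold `M` (charted on the complex normed space `E`): the
Chern–Weil class of the underlying `C^∞` complex vector bundle — the de Rham class of the global
closed `2k`-form `ch_k(E, D) = (1/k!) tr((−Ω/2πi)ᵏ) = tr((i Ω/2π)ᵏ)/k!` of any connection `D`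
(Kobayashi II (2.20)–(2.21), Thm. 2.16; independent of `D` by (2.10); `ch₀ = rank` by (1.10)) —
transported to the singular cohomology `singularCohomology ℂ ℂ M (2 * k)` by the complex de Rham
comparison family `ι` (for a Hodge model `A`, `ι = A.deRham`). It is
`SmoothComplexVectorBundle.chernCharacter` of the transition cocycle `F.toCocycle`; the Hermitian
metric plays no role. [cite: Kobayashi1987, Ch. II §2 Thm. 2.16 and (2.20)–(2.21)] -/
def chernCharacter (F : SmoothHermitianBundle E M) (ι : ComplexDeRhamIsoFamily E) (k : ℕ) :
    singularCohomology ℂ ℂ M (2 * k) :=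
  F.toCocycle.chernCharacter ι k

/-- Unfolding: `ch_k(F) = ι (ch_k^{dR}(F.toCocycle))`. [folklore] -/
theorem chernCharacter_def (F : SmoothHermitianBundle E M) (ι : ComplexDeRhamIsoFamily E) (k : ℕ) :
    F.chernCharacter ι k = ι M (2 * k) (F.toCocycle.chernCharacterDeRham k) :=
  rfl

/-- `ch_k(F)` is the Chern character of the transition cocycle (definitional). [folklore] -/
theorem chernCharacter_eq_toCocycle (F : SmoothHermitianBundle E M) (ι : ComplexDeRhamIsoFamily E)
    (k : ℕ) : F.chernCharacter ι k = F.toCocycle.chernCharacter ι k :=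
  rfl

/-- **`ch₀(F) = rank F`**: `ch₀(F) = r · ι[1]` (Kobayashi II (1.10); unconditional).
[cite: Kobayashi1987, Ch. II §1 (1.10)] -/
theorem chernCharacter_zero (F : SmoothHermitianBundle E M) (ι : ComplexDeRhamIsoFamily E) :
    F.chernCharacter ι 0 = (F.rank : ℂ) • ι M 0 (complexDeRhamCohomology.one E M) :=
  F.toCocycle.chernCharacter_zero ι

/-- **The cocycle of a `C^∞` Hermitian bundle carries a connection** (partition of unity,
`ConnectionExists`). [cite: Kobayashi1987, Ch. I §1 (1.16)] -/
theorem nonempty_connection [FiniteDimensional ℂ E] (F : SmoothHermitianBundle E M) :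
    Nonempty F.toCocycle.Connection :=
  F.toCocycle.nonempty_connection

/-- **Independence of the connection** (granted Chern–Weil II,
`SmoothComplexVectorBundle.mk_eq_mk_of_isChernCharacterForm`): for EVERY connection `D` on the cocycle
of `F` and every global smooth closed `2k`-form `θ` which on each trivialising set is the form
`ch_k(E, D) = (1/k!) tr((−Ω/2πi)ᵏ)` computed in that frame, `ch_k(F) = ι[θ]`.
[cite: Kobayashi1987, Ch. II §2 (2.10) and Thm. 2.16] -/
theorem chernCharacter_eq [FiniteDimensional ℂ E]
    (hB : SmoothComplexVectorBundle.mk_eq_mk_of_isChernCharacterForm E M) (F : SmoothHermitianBundle E M)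
    (ι : ComplexDeRhamIsoFamily E) {k : ℕ} (D : F.toCocycle.Connection) {θ : MForm 𝓘(ℝ, E) M ℂ (2 * k)}
    (hs : IsSmoothForm θ) (hc : IsClosedForm θ) (hθ : D.IsChernCharacterForm k θ) :
    F.chernCharacter ι k =
      ι M (2 * k) (complexDeRhamCohomology.mk E M (2 * k) ⟨θ, mem_cclosedSmoothForms hs hc⟩) :=
  SmoothComplexVectorBundle.chernCharacter_eq hB ι D hs hc hθ

/-- Granted both Chern–Weil facts, the de Rham Chern character of `F` is a genuine Chern–Weil class
(never the junk value: the cocycle of `F` has a connection). [cite: Kobayashi1987, Ch. II §2 (2.4) and (2.10)] -/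
theorem chernCharacterDeRham_mem [FiniteDimensional ℂ E]
    (hA : SmoothComplexVectorBundle.exists_isChernCharacterForm E M)
    (hB : SmoothComplexVectorBundle.mk_eq_mk_of_isChernCharacterForm E M) (F : SmoothHermitianBundle E M)
    (k : ℕ) : F.toCocycle.chernCharacterDeRham k ∈ F.toCocycle.chernCharacterClassSet k :=
  F.nonempty_connection.elim fun D ↦ SmoothComplexVectorBundle.chernCharacterDeRham_mem hA hB D k

/-- Granted both Chern–Weil facts, `ch_k(F) = ι[θ]` for SOME connection `D` on the cocycle of `F` and
its global Chern character form `θ` (existence form of `chernCharacter_eq`). [cite: Kobayashi1987, Ch. II §2 Thm. 2.16] -/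
theorem exists_chernCharacter_eq [FiniteDimensional ℂ E]
    (hA : SmoothComplexVectorBundle.exists_isChernCharacterForm E M)
    (hB : SmoothComplexVectorBundle.mk_eq_mk_of_isChernCharacterForm E M) (F : SmoothHermitianBundle E M)
    (ι : ComplexDeRhamIsoFamily E) (k : ℕ) :
    ∃ (D : F.toCocycle.Connection) (θ : MForm 𝓘(ℝ, E) M ℂ (2 * k)) (hs : IsSmoothForm θ)
      (hc : IsClosedForm θ), D.IsChernCharacterForm k θ ∧
        F.chernCharacter ι k =
          ι M (2 * k) (complexDeRhamCohomology.mk E M (2 * k) ⟨θ, mem_cclosedSmoothForms hs hc⟩) := by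
  obtain ⟨D⟩ := F.nonempty_connection
  obtain ⟨θ, hs, hc, hθ⟩ := hA F.toCocycle D k
  exact ⟨D, θ, hs, hc, hθ, F.chernCharacter_eq hB ι D hs hc hθ⟩

/-- **Additivity under Whitney sums** (Kobayashi II (1.9), `ch(E ⊕ E') = ch(E) + ch(E')`), granted the
two Chern–Weil facts: the Chern character of the Whitney sum of the `C^∞` bundles underlying `F` and
`G` (the direct sum of their transition cocycles, presented on the common refinement of the two
atlases, Kobayashi I (5.14)) is `ch_k(F) + ch_k(G)`. No connection hypothesis is needed
(`ConnectionExists`). [cite: Kobayashi1987, Ch. II §1 (1.9)] -/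
theorem chernCharacter_directSum [FiniteDimensional ℂ E]
    (hA : SmoothComplexVectorBundle.exists_isChernCharacterForm E M)
    (hB : SmoothComplexVectorBundle.mk_eq_mk_of_isChernCharacterForm E M) (F G : SmoothHermitianBundle E M)
    (ι : ComplexDeRhamIsoFamily E) (k : ℕ) :
    (F.toCocycle.directSum G.toCocycle).chernCharacter ι k = F.chernCharacter ι k + G.chernCharacter ι k :=
  SmoothComplexVectorBundle.chernCharacter_directSum hA hB F.nonempty_connection G.nonempty_connection ι k

/-- In degree `0` additivity is unconditional: `rank (F ⊕ G) = rank F + rank G`. [folklore] -/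
theorem chernCharacter_directSum_zero (F G : SmoothHermitianBundle E M) (ι : ComplexDeRhamIsoFamily E) :
    (F.toCocycle.directSum G.toCocycle).chernCharacter ι 0 = F.chernCharacter ι 0 + G.chernCharacter ι 0 :=
  SmoothComplexVectorBundle.chernCharacter_directSum_zero _ _ ι

/-! ### Smooth unitary connections of the carrier compute `ch_k(F)` -/

/-- **A smooth unitary connection of `F` is a connection on its transition cocycle** (the carrier's
`UnitaryConnection E F.Fiber F.metric`, connection forms in atlas frames, read in the reference basis
`F.frameBasis`; `UnitaryConnectionCocycle.toCocycleConnection`). [cite: Kobayashi1987, Ch. I §1 (1.16)] -/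
def _root_.Literature.Geometry.Kaehler.UnitaryConnection.toConnection {F : SmoothHermitianBundle E M}
    (D : UnitaryConnection E F.Fiber F.metric) : F.toCocycle.Connection :=
  D.toCocycleConnection F.frameBasis F.isSmoothCocycle

omit [T2Space M] [SigmaCompactSpace M] in
/-- The connection matrices of `D.toConnection` are the matrices of the connection forms of `D` in the
reference basis (definitional). [folklore] -/
theorem _root_.Literature.Geometry.Kaehler.UnitaryConnection.toConnection_form_apply
    {F : SmoothHermitianBundle E M} (D : UnitaryConnection E F.Fiber F.metric) (x₀ : M) (a c : Fin F.rank)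
    (x : M) (v : Fin 1 → TangentSpace 𝓘(ℝ, E) x) :
    D.toConnection.form x₀ a c x v =
      LinearMap.toMatrix F.frameBasis F.frameBasis (D.form x₀ x v : F.Fiber →ₗ[ℂ] F.Fiber) a c := by
  change (MForm.postcomp (D.form x₀) (entryCLM F.frameBasis a c)) x v = _
  rw [MForm.postcomp_apply, entryCLM_apply]

/-- **`ch_k(F)` from a smooth unitary connection of the carrier** (granted Chern–Weil II): for a smooth
unitary connection `D` on `(F.V, F.metric)` in the sense of `ApproxHermitianYangMills.lean` — e.g. a member
of an approximately Hermitian–Yang–Mills minimising sequence — and every global smooth closed `2k`-form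
`θ` which on each frame domain is its Chern character form `(1/k!) tr((−Ω/2πi)ᵏ)`
(`IsChernCharacterForm` for `D.toConnection`), `ch_k(F) = ι[θ]`. [cite: Kobayashi1987, Ch. II §2 (2.10) and Thm. 2.16] -/
theorem chernCharacter_eq_of_unitaryConnection [FiniteDimensional ℂ E]
    (hB : SmoothComplexVectorBundle.mk_eq_mk_of_isChernCharacterForm E M) (F : SmoothHermitianBundle E M)
    (ι : ComplexDeRhamIsoFamily E) {k : ℕ} (D : UnitaryConnection E F.Fiber F.metric)
    {θ : MForm 𝓘(ℝ, E) M ℂ (2 * k)} (hs : IsSmoothForm θ) (hc : IsClosedForm θ)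
    (hθ : D.toConnection.IsChernCharacterForm k θ) :
    F.chernCharacter ι k =
      ι M (2 * k) (complexDeRhamCohomology.mk E M (2 * k) ⟨θ, mem_cclosedSmoothForms hs hc⟩) :=
  F.chernCharacter_eq hB ι D.toConnection hs hc hθ

/-! ### The trivial Hermitian bundle -/

/-- **`ch₀` of the trivial Hermitian bundle `M × F₀` is `dim F₀ · ι[1]`.** [cite: Kobayashi1987, Ch. II §1 (1.10)] -/
theorem chernCharacter_trivial_zero (F₀ : Type u) [NormedAddCommGroup F₀] [InnerProductSpace ℂ F₀]
    [FiniteDimensional ℂ F₀] (ι : ComplexDeRhamIsoFamily E) :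
    (trivial E M F₀).chernCharacter ι 0 = (finrank ℂ F₀ : ℂ) • ι M 0 (complexDeRhamCohomology.one E M) :=
  (trivial E M F₀).chernCharacter_zero ι

/-- **`ch_{k+1}` of the trivial Hermitian bundle vanishes**, granted Chern–Weil II: its cocycle is `1`
and carries the flat connection with zero forms (`AtlasCocycle.Connection.ofVectorBundleTrivial`), whose
Chern character forms of positive degree vanish. [cite: Kobayashi1987, Ch. II §2 (2.21)] -/
theorem chernCharacter_trivial_succ [FiniteDimensional ℂ E]
    (hB : SmoothComplexVectorBundle.mk_eq_mk_of_isChernCharacterForm E M) (F₀ : Type u)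
    [NormedAddCommGroup F₀] [InnerProductSpace ℂ F₀] [FiniteDimensional ℂ F₀] (ι : ComplexDeRhamIsoFamily E)
    (k : ℕ) : (trivial E M F₀).chernCharacter ι (k + 1) = 0 := by
  rw [(trivial E M F₀).chernCharacter_eq hB ι
    (SmoothComplexVectorBundle.Connection.ofVectorBundleTrivial F₀ (trivial E M F₀).frameBasis
      (trivial E M F₀).isSmoothCocycle)
    isSmoothForm_zero mextDeriv_zero
    (SmoothComplexVectorBundle.Connection.isChernCharacterForm_zero_ofVectorBundleTrivial F₀ _ _ k),
    complexDeRhamCohomology_mk_zero, map_zero]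

end SmoothHermitianBundle

end Literature.Geometry.Kaehler
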